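/-
Copyright (c) 2026 the pub-hodgecm-mathlib formalisation cell (harness21).  Prover seat hodgecm-mathlib-LH3-p02 (g5): line LH3 (closer stub `stub_N9`), LETTER L3′,
organ (S-lin) «`I^st_c(jcH)` and the stable-orbital image are ℂ-linear» — brick #1 of the SURJ-OF-FORWARD road (RULING #22; binder of record LH10-p01 (g5);
LH3-plan (g4) DEAL 2026-09-02T12:32:50Z).  PART A: the space side.
-/
import Literature.NumberTheory.Rogawski1990.ArchBouazizSpace                      -- ★ p849634 (D2-pack): `ArchBouazizSpaceH jcH Ψ`, `archBouazizSpaceH_zero`; ★ (D2-P1) clauses (P)(W)(I₁+I₂)(I₄); ★ (D2-I3) `ArchBzJump`, `bzTwistedDeriv`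
import Literature.NumberTheory.Rogawski1990.ArchBouazizJumpPropagation            -- ★ `contDiff_archERho`; ★ `cayPt_mem_inRegS_insert_of_semiregular`; ★ `bddAbove_norm_iteratedFDeriv_add` (BoundedJetsLeibnizReflection)
import Literature.NumberTheory.Rogawski1990.ArchTransfFamilyJumpKit              -- ★ `hasOneSidedJump_add ∕ _neg ∕ _sum` (one-sided jumps are linear); brings ★ `ArchBouazizStableFamilyJumpZero`: `add_smul_nrm_mem_regS`, `HasOneSidedJump.const_mul ∕ .congr_nhdsWithin ∕ .jump_congr`
import HarnessLib

/-!
# (S-lin), PART A: `I^st_c(jcH) = ArchBouazizSpaceH jcH` IS A ℂ-LINEAR SPACE OF FAMILIES — the step-0 algebra of Bouaziz's surjectivity `𝒟(H_∞)_{inv-st} ↠ I^st(H_∞)`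
# (Bouaziz 1994 §3.1–3.2, §6.2, Thm. 6.2.1 (i); Shelstad 1979 §4 Thm. 4.7)

Topic `NumberTheory/Rogawski1990`; namespace `Literature.NumberTheory.Rogawski1990`.  THEOREMS ONLY (no `def`, no instance, no notation,
no axiom, no named fact, no `sorry`).  Cell `pub/hodgecm-mathlib`, crux H413 (`stmt-HodgeConjecture-24833`), F0∕P3c line LH3 (closer stub `stub_N9`, leaf `F0_P3c_StubN9Direct`),
LETTER L3′ `stub_N9bouazizSurjective`, split «FORWARD ⊕ SURJ-OF-FORWARD» (RULING #22, 2026-09-02T12:30:32Z): organ `BouazizSurjOfForwardStatement` (binder of record LH10-p01 (g5)).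
Brick **(S-lin)** (LH3-plan (g4) DEAL 12:32:50Z → LH3-p02 (g5)): every road to the surjectivity of `fH ↦ stOrbFamH νH fH` onto `ArchBouazizSpaceH jcH` localises `Ψ` by invariant
cut-offs and SUBTRACTS orbital families inside the space — which needs both sides to be ℂ-linear.  Bouaziz §3.2: «`I(U)` l'espace des fonctions … vérifiant (I₁)–(I₄)» is a vector space
clause by clause.  The orbital side (`chartOrbH`, `stOrbFamH`, the image) is PART B ★ `ArchBouazizStableFamilyLinear`.  Count-neutral.

WHAT IS PROVED.
* (§1 is ★: one-sided jumps are linear — `hasOneSidedJump_add ∕ _neg ∕ _sum` of ★ `ArchTransfFamilyJumpKit` (LH3-p04), `HasOneSidedJump.const_mul ∕ .congr_nhdsWithin ∕ .jump_congr` of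
  ★ `ArchBouazizStableFamilyJumpZero` (LH5-p04) — imported and called by name, not restated.)
* §2 the twisted iterated derivative ★ `bzTwistedDeriv S n dirs F c` is additive ∕ homogeneous at every point of the OPEN ★ `InRegS S` where the functions are `C^∞`
  (`bzTwistedDeriv_add_of_mem_inRegS`, `bzTwistedDeriv_const_smul_of_mem_inRegS`; Mathlib `iteratedFDeriv_add_apply` ∕ `iteratedFDeriv_const_smul_apply` at a point of smoothness, the twist
  ★ `archERho S` being `C^∞`, ★ `contDiff_archERho`) and odd unconditionally (`bzTwistedDeriv_neg`, Mathlib `iteratedFDeriv_neg_apply`).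
* §3 clause-wise closures: `ArchBzPeriodic.add ∕ .smul ∕ .neg`, `ArchBzWeyl.add ∕ .smul ∕ .neg`, `ArchBzCompactSupport.add ∕ .smul ∕ .neg` (unconditional); `ArchBzSmoothBounded.add ∕ .smul ∕ .neg`
  (★ `bddAbove_norm_iteratedFDeriv_add`); **`ArchBzJump.add (hΨs hΦs : ArchBzSmoothBounded _) (hΨ hΦ : ArchBzJump jcH _)`**, `ArchBzJump.smul (hΨs : ArchBzSmoothBounded Ψ) (hΨ) (a)`,
  `ArchBzJump.neg` — the jump relations (I₃) are linear because the normal curve `s + ν • nrm w₀` runs in `RegS S` for `0 < |ν| < 1` (★ `add_smul_nrm_mem_regS`) and the Cayley point lies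
  in `InRegS (insert w₀ S)` (★ `cayPt_mem_inRegS_insert_of_semiregular`), so §2 applies on both sides of the relation and ★ `hasOneSidedJump_add` adds the one-sided jumps.
* §4 **`ArchBouazizSpaceH.add ∕ .smul ∕ .neg ∕ .sub ∕ .finset_sum ∕ .add_smul`** — `I^st_c(jcH)` is a ℂ-submodule of the families, for EVERY datum `jcH` (★ `archBouazizSpaceH_zero` is its `0`).
HONEST LABEL: no surjectivity is claimed here; HC_CM is proved only modulo the 7 printed citations (2 remaining: hLiu418 = `stmt-HodgeConjecture-24832`, h413 =
`stmt-HodgeConjecture-24833`) until rung 0 closes; this file is count-neutral.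

## References
* [Bouaziz1994IntegralesOrbitales] A. Bouaziz, *Intégrales orbitales sur les groupes de Lie réductifs*, Ann. Sci. ÉNS 27 (1994) 573–609, §3.1–3.2 pp. 579–580 ((I₁)–(I₄)), §6.2 p. 591
  (`I^st`), Thm. 6.2.1 (i) p. 592.
* [Shelstad1979] D. Shelstad, *Characters and inner forms of a quasi-split group over ℝ*, Compositio Math. 39 (1979), §4 pp. 22–25, Thm. 4.7 p. 31.
-/

set_option autoImplicit false

noncomputable section

open Set Filter Topology Complex Function Real
open scoped ContDiff
open Literature.NumberTheory.Automorphic Literature.NumberTheory.Automorphic.ArchCartan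
open Literature.NumberTheory.Automorphic.Shelstad1979.StableOrbitalIntegrals
open Literature.Analysis.Calculus

namespace Literature.NumberTheory.Rogawski1990

/-! ## §2 The twisted iterated derivative is linear at in-regular points -/

section Twisted

variable {W : Type*} [Fintype W] [DecidableEq W]

/-- **Additivity of the twisted iterated derivative at an in-regular point** for functions `C^∞` on ★ `InRegS S` (open): `D̂ⁿ(F + G) = D̂ⁿF + D̂ⁿG` there (Mathlib
`iteratedFDeriv_add_apply` at a point of smoothness; the twist ★ `archERho S` is `C^∞`, ★ `contDiff_archERho`). [cite: Bouaziz1994IntegralesOrbitales, §3.2 (I₃) p. 580; §6.2 p. 591] -/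
theorem bzTwistedDeriv_add_of_mem_inRegS (S : Finset W) {F G : (W → Fin 3 → ℝ) → ℂ} (hF : ContDiffOn ℝ ∞ F (InRegS S)) (hG : ContDiffOn ℝ ∞ G (InRegS S))
    {c : W → Fin 3 → ℝ} (hc : c ∈ InRegS S) (n : ℕ) (dirs : Fin n → (W → Fin 3 → ℝ)) :
    bzTwistedDeriv S n dirs (F + G) c = bzTwistedDeriv S n dirs F c + bzTwistedDeriv S n dirs G c := by
  have hO : IsOpen (InRegS S) := isOpen_inRegS S
  have hf : ContDiffAt ℝ n (fun c => archERho S c * F c) c :=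
    (((contDiff_archERho S).contDiffOn.mul hF).contDiffAt (hO.mem_nhds hc)).of_le (by exact_mod_cast le_top)
  have hg : ContDiffAt ℝ n (fun c => archERho S c * G c) c :=
    (((contDiff_archERho S).contDiffOn.mul hG).contDiffAt (hO.mem_nhds hc)).of_le (by exact_mod_cast le_top)
  have hsum : (fun c => archERho S c * (F + G) c) = (fun c => archERho S c * F c) + fun c => archERho S c * G c := by
    funext x
    simp only [Pi.add_apply, mul_add]
  unfold bzTwistedDeriv
  rw [hsum, iteratedFDeriv_add_apply hf hg, _root_.add_apply, mul_add]

/-- **Homogeneity of the twisted iterated derivative at an in-regular point**: `D̂ⁿ(a • F) = a · D̂ⁿF` on ★ `InRegS S` for `F` `C^∞` there.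
[cite: Bouaziz1994IntegralesOrbitales, §3.2 (I₃) p. 580] -/
theorem bzTwistedDeriv_const_smul_of_mem_inRegS (S : Finset W) {F : (W → Fin 3 → ℝ) → ℂ} (hF : ContDiffOn ℝ ∞ F (InRegS S)) (a : ℂ)
    {c : W → Fin 3 → ℝ} (hc : c ∈ InRegS S) (n : ℕ) (dirs : Fin n → (W → Fin 3 → ℝ)) :
    bzTwistedDeriv S n dirs (a • F) c = a * bzTwistedDeriv S n dirs F c := by
  have hO : IsOpen (InRegS S) := isOpen_inRegS S
  have hf : ContDiffAt ℝ n (fun c => archERho S c * F c) c :=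
    (((contDiff_archERho S).contDiffOn.mul hF).contDiffAt (hO.mem_nhds hc)).of_le (by exact_mod_cast le_top)
  have hsm : (fun c => archERho S c * (a • F) c) = a • fun c => archERho S c * F c := by
    funext x
    simp only [Pi.smul_apply, smul_eq_mul]
    ring
  unfold bzTwistedDeriv
  rw [hsm, iteratedFDeriv_const_smul_apply hf, _root_.smul_apply, smul_eq_mul]
  ring

/-- The twisted iterated derivative is odd: `D̂ⁿ(−F) = −D̂ⁿF` (everywhere, no smoothness needed: Mathlib `iteratedFDeriv_neg_apply`).
[cite: Bouaziz1994IntegralesOrbitales, §3.2 (I₃) p. 580] -/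
theorem bzTwistedDeriv_neg (S : Finset W) (F : (W → Fin 3 → ℝ) → ℂ) (c : W → Fin 3 → ℝ) (n : ℕ) (dirs : Fin n → (W → Fin 3 → ℝ)) :
    bzTwistedDeriv S n dirs (-F) c = -bzTwistedDeriv S n dirs F c := by
  have hng : (fun c => archERho S c * (-F) c) = -fun c => archERho S c * F c := by
    funext x
    simp only [Pi.neg_apply, mul_neg]
  unfold bzTwistedDeriv
  rw [hng, iteratedFDeriv_neg_apply, _root_.neg_apply, mul_neg]

end Twisted

/-! ## §3 Clause-wise closures -/

section Clauses

variable {W : Type*} [Fintype W] [DecidableEq W]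

omit [Fintype W] in
/-- (P) is additive. [cite: Bouaziz1994IntegralesOrbitales, §3.1 p. 579] -/
theorem ArchBzPeriodic.add {Ψ Φ : Finset W → (W → Fin 3 → ℝ) → ℂ} (hΨ : ArchBzPeriodic Ψ) (hΦ : ArchBzPeriodic Φ) : ArchBzPeriodic (Ψ + Φ) := by
  intro S c w i k h
  simp only [Pi.add_apply, hΨ S c w i k h, hΦ S c w i k h]

omit [Fintype W] in
/-- (P) is homogeneous. [cite: Bouaziz1994IntegralesOrbitales, §3.1 p. 579] -/
theorem ArchBzPeriodic.smul {Ψ : Finset W → (W → Fin 3 → ℝ) → ℂ} (hΨ : ArchBzPeriodic Ψ) (a : ℂ) : ArchBzPeriodic (a • Ψ) := by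
  intro S c w i k h
  simp only [Pi.smul_apply, hΨ S c w i k h]

omit [Fintype W] in
/-- (P) is stable under negation. [cite: Bouaziz1994IntegralesOrbitales, §3.1 p. 579] -/
theorem ArchBzPeriodic.neg {Ψ : Finset W → (W → Fin 3 → ℝ) → ℂ} (hΨ : ArchBzPeriodic Ψ) : ArchBzPeriodic (-Ψ) := by
  intro S c w i k h
  simp only [Pi.neg_apply, hΨ S c w i k h]

/-- (W) is additive (both halves are linear identities in `Ψ`). [cite: Shelstad1979, §4 p. 23] -/
theorem ArchBzWeyl.add {Ψ Φ : Finset W → (W → Fin 3 → ℝ) → ℂ} (hΨ : ArchBzWeyl Ψ) (hΦ : ArchBzWeyl Φ) : ArchBzWeyl (Ψ + Φ) := by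
  refine ⟨fun S c w hw => ?_, fun S c w hw => ?_⟩
  · simp only [Pi.add_apply, add_mul, mul_add, hΨ.1 S c w hw, hΦ.1 S c w hw]
  · simp only [Pi.add_apply, hΨ.2 S c w hw, hΦ.2 S c w hw]

/-- (W) is homogeneous. [cite: Shelstad1979, §4 p. 23] -/
theorem ArchBzWeyl.smul {Ψ : Finset W → (W → Fin 3 → ℝ) → ℂ} (hΨ : ArchBzWeyl Ψ) (a : ℂ) : ArchBzWeyl (a • Ψ) := by
  refine ⟨fun S c w hw => ?_, fun S c w hw => ?_⟩
  · simp only [Pi.smul_apply, smul_eq_mul]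
    rw [mul_assoc, hΨ.1 S c w hw]
    ring
  · simp only [Pi.smul_apply, hΨ.2 S c w hw]

/-- (W) is stable under negation. [cite: Shelstad1979, §4 p. 23] -/
theorem ArchBzWeyl.neg {Ψ : Finset W → (W → Fin 3 → ℝ) → ℂ} (hΨ : ArchBzWeyl Ψ) : ArchBzWeyl (-Ψ) := by
  refine ⟨fun S c w hw => ?_, fun S c w hw => ?_⟩
  · simp only [Pi.neg_apply, neg_mul, mul_neg, hΨ.1 S c w hw]
  · simp only [Pi.neg_apply, hΨ.2 S c w hw]

omit [Fintype W] [DecidableEq W] in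
/-- (I₄) is additive (take the larger of the two split-support bounds). [cite: Bouaziz1994IntegralesOrbitales, §3.1 (I₄) p. 579] -/
theorem ArchBzCompactSupport.add {Ψ Φ : Finset W → (W → Fin 3 → ℝ) → ℂ} (hΨ : ArchBzCompactSupport Ψ) (hΦ : ArchBzCompactSupport Φ) :
    ArchBzCompactSupport (Ψ + Φ) := by
  intro S
  obtain ⟨R₁, h₁⟩ := hΨ S
  obtain ⟨R₂, h₂⟩ := hΦ S
  refine ⟨max R₁ R₂, fun c hc => ?_⟩
  obtain ⟨w, hw, hR⟩ := hc
  simp only [Pi.add_apply, h₁ c ⟨w, hw, (le_max_left R₁ R₂).trans_lt hR⟩, h₂ c ⟨w, hw, (le_max_right R₁ R₂).trans_lt hR⟩, add_zero]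

omit [Fintype W] [DecidableEq W] in
/-- (I₄) is homogeneous. [cite: Bouaziz1994IntegralesOrbitales, §3.1 (I₄) p. 579] -/
theorem ArchBzCompactSupport.smul {Ψ : Finset W → (W → Fin 3 → ℝ) → ℂ} (hΨ : ArchBzCompactSupport Ψ) (a : ℂ) : ArchBzCompactSupport (a • Ψ) := by
  intro S
  obtain ⟨R₁, h₁⟩ := hΨ S
  refine ⟨R₁, fun c hc => ?_⟩
  simp only [Pi.smul_apply, h₁ c hc, smul_zero]

omit [Fintype W] [DecidableEq W] in
/-- (I₄) is stable under negation. [cite: Bouaziz1994IntegralesOrbitales, §3.1 (I₄) p. 579] -/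
theorem ArchBzCompactSupport.neg {Ψ : Finset W → (W → Fin 3 → ℝ) → ℂ} (hΨ : ArchBzCompactSupport Ψ) : ArchBzCompactSupport (-Ψ) := by
  intro S
  obtain ⟨R₁, h₁⟩ := hΨ S
  refine ⟨R₁, fun c hc => ?_⟩
  simp only [Pi.neg_apply, h₁ c hc, neg_zero]

omit [DecidableEq W] in
/-- **(I₁)+(I₂) is additive**: `C^∞` on `InRegS S` is additive, and bounded jets add (★ `bddAbove_norm_iteratedFDeriv_add` on the open `InRegS S`).
[cite: Bouaziz1994IntegralesOrbitales, §3.1 (I₁)–(I₂) p. 579] -/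
theorem ArchBzSmoothBounded.add {Ψ Φ : Finset W → (W → Fin 3 → ℝ) → ℂ} (hΨ : ArchBzSmoothBounded Ψ) (hΦ : ArchBzSmoothBounded Φ) :
    ArchBzSmoothBounded (Ψ + Φ) := by
  intro S
  refine ⟨(hΨ S).1.add (hΦ S).1, fun n K hK => ?_⟩
  have h := bddAbove_norm_iteratedFDeriv_add (isOpen_inRegS S) (inter_subset_right : K ∩ InRegS S ⊆ InRegS S) (hΨ S).1 (hΦ S).1
    ((hΨ S).2 n K hK) ((hΦ S).2 n K hK)
  simpa only [Pi.add_apply] using h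

omit [DecidableEq W] in
/-- **(I₁)+(I₂) is homogeneous** (`Dⁿ(a • F) = a • DⁿF` at points of smoothness). [cite: Bouaziz1994IntegralesOrbitales, §3.1 (I₁)–(I₂) p. 579] -/
theorem ArchBzSmoothBounded.smul {Ψ : Finset W → (W → Fin 3 → ℝ) → ℂ} (hΨ : ArchBzSmoothBounded Ψ) (a : ℂ) : ArchBzSmoothBounded (a • Ψ) := by
  intro S
  have hO : IsOpen (InRegS S) := isOpen_inRegS S
  refine ⟨(hΨ S).1.const_smul a, fun n K hK => ?_⟩
  · obtain ⟨C, hC⟩ := (hΨ S).2 n K hK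
    refine ⟨‖a‖ * C, ?_⟩
    rintro _ ⟨y, hy, rfl⟩
    have hya : ContDiffAt ℝ n (Ψ S) y := (((hΨ S).1).contDiffAt (hO.mem_nhds hy.2)).of_le (by exact_mod_cast le_top)
    have hfun : (a • Ψ) S = a • Ψ S := by
      funext x
      simp only [Pi.smul_apply]
    dsimp only
    rw [hfun, iteratedFDeriv_const_smul_apply hya, norm_smul]
    exact mul_le_mul_of_nonneg_left (mem_upperBounds.1 hC _ ⟨y, hy, rfl⟩) (norm_nonneg a)

omit [DecidableEq W] in
/-- **(I₁)+(I₂) is stable under negation** (`Dⁿ(−F) = −DⁿF`, same norms). [cite: Bouaziz1994IntegralesOrbitales, §3.1 (I₁)–(I₂) p. 579] -/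
theorem ArchBzSmoothBounded.neg {Ψ : Finset W → (W → Fin 3 → ℝ) → ℂ} (hΨ : ArchBzSmoothBounded Ψ) : ArchBzSmoothBounded (-Ψ) := by
  intro S
  refine ⟨(hΨ S).1.neg, fun n K hK => ?_⟩
  · obtain ⟨C, hC⟩ := (hΨ S).2 n K hK
    refine ⟨C, ?_⟩
    rintro _ ⟨y, hy, rfl⟩
    have hfun : (-Ψ) S = -Ψ S := by
      funext x
      simp only [Pi.neg_apply]
    dsimp only
    rw [hfun, iteratedFDeriv_neg_apply, norm_neg]
    exact mem_upperBounds.1 hC _ ⟨y, hy, rfl⟩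

/-- **(I₃) IS ADDITIVE on smooth-bounded families**: at a semiregular wall point `s` of `w₀ ∉ S` the normal curve `s + ν • nrm w₀` lies in `RegS S ⊆ InRegS S` for `0 < |ν| < 1`
(★ `add_smul_nrm_mem_regS`) and the Cayley point lies in `InRegS (insert w₀ S)` (★ `cayPt_mem_inRegS_insert_of_semiregular`); there the twisted jets of `Ψ + Φ` are the sums
of the twisted jets (§2), so the two jump relations add (★ `hasOneSidedJump_add`). [cite: Bouaziz1994IntegralesOrbitales, §3.2 (I₃) p. 580; §6.2 p. 591] [cite: Shelstad1979, Thm. 4.7 (p. 31)] -/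
theorem ArchBzJump.add {jcH : Finset W → W → ℂ} {Ψ Φ : Finset W → (W → Fin 3 → ℝ) → ℂ} (hΨs : ArchBzSmoothBounded Ψ) (hΦs : ArchBzSmoothBounded Φ)
    (hΨ : ArchBzJump jcH Ψ) (hΦ : ArchBzJump jcH Φ) : ArchBzJump jcH (Ψ + Φ) := by
  intro S w₀ hw₀ s hs hreg hregS n m
  have h1 := hΨ S w₀ hw₀ s hs hreg hregS n m
  have h2 := hΦ S w₀ hw₀ s hs hreg hregS n m
  have hcay : cayPt w₀ s ∈ InRegS (insert w₀ S) := cayPt_mem_inRegS_insert_of_semiregular S w₀ hreg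
  -- the curve readings agree with the sums on both punctured sides
  have hev : ∀ ν : ℝ, ν ∈ Ioo (-1 : ℝ) 1 → ν ≠ 0 →
      bzTwistedDeriv S n (fun j => bzAdaptedVec w₀ (m j)) ((Ψ + Φ) S) (s + ν • nrm w₀) =
        bzTwistedDeriv S n (fun j => bzAdaptedVec w₀ (m j)) (Ψ S) (s + ν • nrm w₀) + bzTwistedDeriv S n (fun j => bzAdaptedVec w₀ (m j)) (Φ S) (s + ν • nrm w₀) := by
    intro ν hν hν0
    have hmem : s + ν • nrm w₀ ∈ InRegS S := regS_subset_inRegS S (add_smul_nrm_mem_regS S hw₀ hs hreg hregS hν hν0)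
    rw [show (Ψ + Φ) S = Ψ S + Φ S from rfl]
    exact bzTwistedDeriv_add_of_mem_inRegS S (hΨs S).1 (hΦs S).1 hmem n _
  have hp : (fun ν : ℝ => bzTwistedDeriv S n (fun j => bzAdaptedVec w₀ (m j)) ((Ψ + Φ) S) (s + ν • nrm w₀)) =ᶠ[𝓝[>] (0 : ℝ)]
      fun ν => bzTwistedDeriv S n (fun j => bzAdaptedVec w₀ (m j)) (Ψ S) (s + ν • nrm w₀) + bzTwistedDeriv S n (fun j => bzAdaptedVec w₀ (m j)) (Φ S) (s + ν • nrm w₀) := by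
    filter_upwards [Ioo_mem_nhdsGT (zero_lt_one' ℝ)] with ν hν
    exact hev ν ⟨by linarith [hν.1], hν.2⟩ hν.1.ne'
  have hm' : (fun ν : ℝ => bzTwistedDeriv S n (fun j => bzAdaptedVec w₀ (m j)) ((Ψ + Φ) S) (s + ν • nrm w₀)) =ᶠ[𝓝[<] (0 : ℝ)]
      fun ν => bzTwistedDeriv S n (fun j => bzAdaptedVec w₀ (m j)) (Ψ S) (s + ν • nrm w₀) + bzTwistedDeriv S n (fun j => bzAdaptedVec w₀ (m j)) (Φ S) (s + ν • nrm w₀) := by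
    filter_upwards [Ioo_mem_nhdsLT (neg_lt_zero.2 (zero_lt_one' ℝ))] with ν hν
    exact hev ν ⟨hν.1, by linarith [hν.2]⟩ hν.2.ne
  refine HasOneSidedJump.jump_congr (HasOneSidedJump.congr_nhdsWithin (hasOneSidedJump_add h1 h2) hp hm') ?_
  rw [show (Ψ + Φ) (insert w₀ S) = Ψ (insert w₀ S) + Φ (insert w₀ S) from rfl,
    bzTwistedDeriv_add_of_mem_inRegS (insert w₀ S) (hΨs (insert w₀ S)).1 (hΦs (insert w₀ S)).1 hcay n _]
  ring

/-- **(I₃) IS HOMOGENEOUS on smooth-bounded families.** [cite: Bouaziz1994IntegralesOrbitales, §3.2 (I₃) p. 580] [cite: Shelstad1979, Thm. 4.7 (p. 31)] -/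
theorem ArchBzJump.smul {jcH : Finset W → W → ℂ} {Ψ : Finset W → (W → Fin 3 → ℝ) → ℂ} (hΨs : ArchBzSmoothBounded Ψ) (hΨ : ArchBzJump jcH Ψ) (a : ℂ) :
    ArchBzJump jcH (a • Ψ) := by
  intro S w₀ hw₀ s hs hreg hregS n m
  have h1 := hΨ S w₀ hw₀ s hs hreg hregS n m
  have hcay : cayPt w₀ s ∈ InRegS (insert w₀ S) := cayPt_mem_inRegS_insert_of_semiregular S w₀ hreg
  have hev : ∀ ν : ℝ, ν ∈ Ioo (-1 : ℝ) 1 → ν ≠ 0 →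
      bzTwistedDeriv S n (fun j => bzAdaptedVec w₀ (m j)) ((a • Ψ) S) (s + ν • nrm w₀) =
        a * bzTwistedDeriv S n (fun j => bzAdaptedVec w₀ (m j)) (Ψ S) (s + ν • nrm w₀) := by
    intro ν hν hν0
    have hmem : s + ν • nrm w₀ ∈ InRegS S := regS_subset_inRegS S (add_smul_nrm_mem_regS S hw₀ hs hreg hregS hν hν0)
    rw [show (a • Ψ) S = a • Ψ S from rfl]
    exact bzTwistedDeriv_const_smul_of_mem_inRegS S (hΨs S).1 a hmem n _
  have hp : (fun ν : ℝ => bzTwistedDeriv S n (fun j => bzAdaptedVec w₀ (m j)) ((a • Ψ) S) (s + ν • nrm w₀)) =ᶠ[𝓝[>] (0 : ℝ)]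
      fun ν => a * bzTwistedDeriv S n (fun j => bzAdaptedVec w₀ (m j)) (Ψ S) (s + ν • nrm w₀) := by
    filter_upwards [Ioo_mem_nhdsGT (zero_lt_one' ℝ)] with ν hν
    exact hev ν ⟨by linarith [hν.1], hν.2⟩ hν.1.ne'
  have hm' : (fun ν : ℝ => bzTwistedDeriv S n (fun j => bzAdaptedVec w₀ (m j)) ((a • Ψ) S) (s + ν • nrm w₀)) =ᶠ[𝓝[<] (0 : ℝ)]
      fun ν => a * bzTwistedDeriv S n (fun j => bzAdaptedVec w₀ (m j)) (Ψ S) (s + ν • nrm w₀) := by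
    filter_upwards [Ioo_mem_nhdsLT (neg_lt_zero.2 (zero_lt_one' ℝ))] with ν hν
    exact hev ν ⟨hν.1, by linarith [hν.2]⟩ hν.2.ne
  refine HasOneSidedJump.jump_congr (HasOneSidedJump.congr_nhdsWithin (HasOneSidedJump.const_mul a h1) hp hm') ?_
  rw [show (a • Ψ) (insert w₀ S) = a • Ψ (insert w₀ S) from rfl, bzTwistedDeriv_const_smul_of_mem_inRegS (insert w₀ S) (hΨs (insert w₀ S)).1 a hcay n _]
  ring

/-- **(I₃) IS STABLE UNDER NEGATION** (no smoothness needed: ★ `bzTwistedDeriv_neg`). [cite: Bouaziz1994IntegralesOrbitales, §3.2 (I₃) p. 580] -/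
theorem ArchBzJump.neg {jcH : Finset W → W → ℂ} {Ψ : Finset W → (W → Fin 3 → ℝ) → ℂ} (hΨ : ArchBzJump jcH Ψ) : ArchBzJump jcH (-Ψ) := by
  intro S w₀ hw₀ s hs hreg hregS n m
  have h1 := hasOneSidedJump_neg (hΨ S w₀ hw₀ s hs hreg hregS n m)
  have hfun : (fun ν : ℝ => bzTwistedDeriv S n (fun j => bzAdaptedVec w₀ (m j)) ((-Ψ) S) (s + ν • nrm w₀)) =
      fun ν => -bzTwistedDeriv S n (fun j => bzAdaptedVec w₀ (m j)) (Ψ S) (s + ν • nrm w₀) := by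
    funext ν
    rw [show (-Ψ) S = -Ψ S from rfl, bzTwistedDeriv_neg]
  rw [hfun]
  refine HasOneSidedJump.jump_congr h1 ?_
  rw [show (-Ψ) (insert w₀ S) = -Ψ (insert w₀ S) from rfl, bzTwistedDeriv_neg]
  ring

end Clauses

/-! ## §4 `I^st_c(jcH)` is a ℂ-linear space of families -/

section Space

variable {W : Type*} [Fintype W] [DecidableEq W]

/-- **`ArchBouazizSpaceH jcH` IS CLOSED UNDER ADDITION** (all five clauses add; (I₃) uses the (I₁)+(I₂) clauses of both summands). [cite: Bouaziz1994IntegralesOrbitales, §3.2 p. 580; §6.2 p. 591] -/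
theorem ArchBouazizSpaceH.add {jcH : Finset W → W → ℂ} {Ψ Φ : Finset W → (W → Fin 3 → ℝ) → ℂ} (hΨ : ArchBouazizSpaceH jcH Ψ) (hΦ : ArchBouazizSpaceH jcH Φ) :
    ArchBouazizSpaceH jcH (Ψ + Φ) :=
  ⟨hΨ.periodic.add hΦ.periodic, hΨ.weyl.add hΦ.weyl, hΨ.smoothBounded.add hΦ.smoothBounded,
    hΨ.jump.add hΨ.smoothBounded hΦ.smoothBounded hΦ.jump, hΨ.compactSupport.add hΦ.compactSupport⟩

/-- **`ArchBouazizSpaceH jcH` IS CLOSED UNDER SCALARS.** [cite: Bouaziz1994IntegralesOrbitales, §3.2 p. 580; §6.2 p. 591] -/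
theorem ArchBouazizSpaceH.smul {jcH : Finset W → W → ℂ} {Ψ : Finset W → (W → Fin 3 → ℝ) → ℂ} (hΨ : ArchBouazizSpaceH jcH Ψ) (a : ℂ) :
    ArchBouazizSpaceH jcH (a • Ψ) :=
  ⟨hΨ.periodic.smul a, hΨ.weyl.smul a, hΨ.smoothBounded.smul a, hΨ.jump.smul hΨ.smoothBounded a, hΨ.compactSupport.smul a⟩

/-- **`ArchBouazizSpaceH jcH` IS CLOSED UNDER NEGATION.** [cite: Bouaziz1994IntegralesOrbitales, §3.2 p. 580] -/
theorem ArchBouazizSpaceH.neg {jcH : Finset W → W → ℂ} {Ψ : Finset W → (W → Fin 3 → ℝ) → ℂ} (hΨ : ArchBouazizSpaceH jcH Ψ) : ArchBouazizSpaceH jcH (-Ψ) :=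
  ⟨hΨ.periodic.neg, hΨ.weyl.neg, hΨ.smoothBounded.neg, hΨ.jump.neg, hΨ.compactSupport.neg⟩

/-- **`ArchBouazizSpaceH jcH` IS CLOSED UNDER SUBTRACTION** (the form the surjectivity road uses: `Ψ − stOrbFamH νH f₁` stays in the space).
[cite: Bouaziz1994IntegralesOrbitales, §3.2 p. 580; Thm. 6.2.1 (i) p. 592] -/
theorem ArchBouazizSpaceH.sub {jcH : Finset W → W → ℂ} {Ψ Φ : Finset W → (W → Fin 3 → ℝ) → ℂ} (hΨ : ArchBouazizSpaceH jcH Ψ) (hΦ : ArchBouazizSpaceH jcH Φ) :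
    ArchBouazizSpaceH jcH (Ψ - Φ) := by
  rw [sub_eq_add_neg]
  exact hΨ.add hΦ.neg

/-- **`ArchBouazizSpaceH jcH` IS CLOSED UNDER FINITE SUMS** (partitions of unity). [cite: Bouaziz1994IntegralesOrbitales, §3.2 p. 580; §6.2 p. 591] -/
theorem ArchBouazizSpaceH.finset_sum {jcH : Finset W → W → ℂ} {ι : Type*} (s : Finset ι) {Ψ : ι → Finset W → (W → Fin 3 → ℝ) → ℂ}
    (h : ∀ i ∈ s, ArchBouazizSpaceH jcH (Ψ i)) : ArchBouazizSpaceH jcH (∑ i ∈ s, Ψ i) := by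
  classical
  induction s using Finset.induction_on with
  | empty =>
    rw [Finset.sum_empty]
    exact archBouazizSpaceH_zero jcH
  | insert a s ha ih =>
    rw [Finset.sum_insert ha]
    exact (h a (Finset.mem_insert_self a s)).add (ih fun i hi => h i (Finset.mem_insert_of_mem hi))

/-- Linear combinations stay in the space. [cite: Bouaziz1994IntegralesOrbitales, §3.2 p. 580] -/
theorem ArchBouazizSpaceH.add_smul {jcH : Finset W → W → ℂ} {Ψ Φ : Finset W → (W → Fin 3 → ℝ) → ℂ} (hΨ : ArchBouazizSpaceH jcH Ψ) (hΦ : ArchBouazizSpaceH jcH Φ)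
    (a b : ℂ) : ArchBouazizSpaceH jcH (a • Ψ + b • Φ) :=
  (hΨ.smul a).add (hΦ.smul b)

end Space

end Literature.NumberTheory.Rogawski1990

end
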